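/-
Copyright (c) 2026 the pub-hodgecm-mathlib formalisation cell (harness21).  Prover seat hodgecm-mathlib-B-p14 (g35): road «S3-tree» (LEAD F0P3a-plan (g11); architect A-p16 (g28∕g29);
acting architect F0P3-p01 (g16)), brick T1d′ «discharging `htr₂`», FILE 3 = TYPE-TWO TRANSITIVITY AND THE UNCONDITIONAL TREE; 2026-09-01.
-/
import Literature.NumberTheory.Automorphic.UnitaryLatticeTreeTypeTwoHyperbolic   -- ★ T1d′ FILE 2 (B-p14 (g35)): `exists_adapted_vectors_of_isVertexLattice_two`
import Literature.NumberTheory.Automorphic.UnitaryLatticeTreeIsTree             -- ★ T1d-C3 (B-p14 (g35)): `isTree_latticeGraph_three (hd) (htr₂)`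
import Literature.NumberTheory.Automorphic.UnitaryGroupRankOneBigCell            -- ★ `UnitaryGroup.antidiagonal_three_over_eq` (`J₀` as an explicit matrix)
import HarnessLib

/-!
# The lattice graph of a hermitian space — XIII: `U(J₀)` IS TRANSITIVE ON THE TYPE-TWO VERTICES (the binder `htr₂` discharged), and the Bruhat–Tits tree of the unramified
# `U(3)` UNCONDITIONALLY in the datum (Jacobowitz 1962 §4, §7; Bruhat–Tits 1972 §10; Serre, *Trees* II.1.1)

Topic `NumberTheory/Automorphic`; namespace `Literature.NumberTheory.Automorphic.UnitaryLatticeTree`.  THEOREMS ONLY (no definition, no instance, no notation, no named fact,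
no `sorry`); kernel lane.  Cell `pub/hodgecm-mathlib` (D-0151), crux H413 = `stmt-HodgeConjecture-24833`; road «S3-tree», brick **T1d′** FILE 3 of 3.
HONEST LABEL: HC_CM is proved only modulo the 2 remaining named inputs (hLiu418 24832, h413 24833) until rung 0 closes; nothing printed is asserted here (elementary lattice algebra
over a valuation ring with involution); S3 stays a print row until the road's END lands.

THE MATHEMATICS.  FILE 2 gives `x, f₀, f₂ ∈ M` with Gram matrix `[[0,0,ϖ],[0,ε,0],[ϖ,0,0]]` (`|ε| = 1`) for the columns `(f₀, x, f₂)`.  (§37) The DETERMINANT CLASS: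
`det(ᵗσ(C)J₀C) = σ(det C)·det J₀·det C` forces `ε = N(z)`, `z = det C ∕ ϖ` a unit, so `c₁ = z⁻¹x ∈ M` has `h(c₁,c₁) = 1`; (§38) the matrix `u` with columns `(f₀, c₁, ϖ⁻¹f₂)`
has `ᵗσ(u)J₀u = J₀`, i.e. `u ∈ U(J₀)`, and `u·N₁ = latt(f₀, c₁, f₂) ≤ M`; both are type-two vertices, so `u·N₁ = M` by (D1)∕(D2) — **`exists_mapGL_N₁_eq_of_isVertexLattice_two`**
= the binder `htr₂` of ★ `isTree_latticeGraph_three` DISCHARGED for every unramified datum (no finiteness of the residue field is used: the residual isotropy comes from the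
isotropy of `J₀`, exact isotropy from the norm equation (★ `hd.norm`), the unit class from the determinant).  (§39) COROLLARIES: **`isTree_latticeGraph_three_of_unramified`**
`(hd : UnramifiedLocalConjDatum σ ϖ) : (latticeGraph σ ϖ J₀).IsTree` and the `htr₂`-free parent law `latticeParent_spec_of_isVertexLattice_two_of_unramified`.

## References
* [Jacobowitz1962] R. Jacobowitz, *Hermitian forms over local fields*, Amer. J. Math. 84 (1962), §4 (Jordan splittings), §7 (unramified case: modular lattices are classified by rank).
* [BruhatTits1972] F. Bruhat, J. Tits, *Groupes réductifs sur un corps local I*, Publ. Math. IHÉS 41 (1972), §10.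
* [Tits1979] J. Tits, *Reductive groups over local fields*, PSPM 33.1 (1979), §3.3.3.
* [Serre1980Trees] J.-P. Serre, *Trees* (1980), Ch. II §1.1.
-/

set_option autoImplicit false

noncomputable section

open scoped Valued WithZero Matrix MatrixGroups

namespace Literature.NumberTheory.Automorphic.UnitaryLatticeTree

open Literature.NumberTheory.Automorphic Literature.NumberTheory.Automorphic.HermitianLattice
open Literature.NumberTheory.Automorphic.CartanUnique

variable {K : Type*} [Field K] [Valued K ℤᵐ⁰] {σ : K →+* K} {ϖ : K} {N : ℕ}

/-! ## §37 Gram matrices of column matrices; the determinant class -/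

omit [Valued K ℤᵐ⁰] in
/-- **Gram entries of a column matrix**: `B₀ (A eᵢ) (A eⱼ) = (ᵗσ(A)J₀A)ᵢⱼ` for ANY square matrix `A`. [cite: Jacobowitz1962, §4] -/
theorem B₀_mulVec_single_eq_gram (A : Matrix (Fin N) (Fin N) K) (i j : Fin N) :
    B₀ σ N (A.mulVec (Pi.single i 1)) (A.mulVec (Pi.single j 1)) = ((A.map σ)ᵀ * (StdForm.antidiagonal N).over K * A) i j := by
  rw [← pairing_antidiagonal, pairing_mulVec_left, pairing_mulVec_right, pairing_single_single]

omit [Valued K ℤᵐ⁰] in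
/-- The columns of the transpose of a row-stack: `(of v)ᵀ e_j = v j`. [cite: Jacobowitz1962, §4] -/
theorem transpose_of_mulVec_single (v : Fin 3 → Fin 3 → K) (j : Fin 3) : ((Matrix.of v)ᵀ).mulVec (Pi.single j 1) = v j := by
  funext i; rw [Matrix.mulVec_single_one]; rfl

omit [Valued K ℤᵐ⁰] in
/-- `det J₀ = −1` on `K³`. [cite: Tits1979, §3.3.3] -/
theorem det_antidiagonal_three : ((StdForm.antidiagonal 3).over K).det = -1 := by
  have hJ : ∀ i j : Fin 3, (StdForm.antidiagonal 3).over K i j = if j = Fin.rev i then (1 : K) else 0 := by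
    intro i j
    simp only [StdForm.over, Matrix.map_apply, StdForm.antidiagonal_J_apply]
    split_ifs <;> simp
  rw [Matrix.det_fin_three]; simp [hJ, Fin.rev]

omit [Valued K ℤᵐ⁰] in
/-- **The determinant class**: `det(ᵗσ(A)J₀A) = −σ(det A)·det A` on `K³`. [cite: Jacobowitz1962, §3] -/
theorem det_gram_three (A : Matrix (Fin 3) (Fin 3) K) : ((A.map σ)ᵀ * (StdForm.antidiagonal 3).over K * A).det = -(σ A.det * A.det) := by
  rw [Matrix.det_mul, Matrix.det_mul, Matrix.det_transpose, det_antidiagonal_three,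
    show (A.map σ).det = σ A.det by rw [RingHom.map_det, RingHom.mapMatrix_apply]]
  ring

/-! ## §38 Type-two transitivity: `M = u·N₁` -/

/-- **`U(J₀)` IS TRANSITIVE ON THE TYPE-TWO VERTICES** (`N = 3`, unramified datum `hd`; no finiteness of the residue field): every type-two vertex lattice `M` of `(K³, J₀)` is
`u·N₁`, `N₁ = latt diag(1,1,ϖ)`, for some `u ∈ U(J₀)` — the binder `htr₂` of ★ `isTree_latticeGraph_three` ∕ ★ `latticeParent_spec_of_isVertexLattice_two` ∕ ★
`exists_normalForm_of_type_two`.  From the adapted vectors `x, f₀, f₂ ∈ M` of ★ `exists_adapted_vectors_of_isVertexLattice_two`: `ε = h(x,x) = N(det C∕ϖ)` by the determinant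
class, so `c₁ = (det C∕ϖ)⁻¹x` has `h(c₁,c₁) = 1`; the matrix `u = (f₀ | c₁ | ϖ⁻¹f₂)` satisfies `ᵗσ(u)J₀u = J₀` and `u·N₁ = latt(f₀|c₁|f₂) ≤ M`, two type-two vertices, equal
by (D1)∕(D2). [cite: Jacobowitz1962, §4, §7] [cite: BruhatTits1972, §10] -/
theorem exists_mapGL_N₁_eq_of_isVertexLattice_two (hd : UnramifiedLocalConjDatum σ ϖ) {M : Submodule 𝒪[K] (Fin 3 → K)}
    (hM : IsVertexLattice σ ϖ ((StdForm.antidiagonal 3).over K) 2 M) :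
    ∃ u : unitaryGroupOfForm σ ((StdForm.antidiagonal 3).over K), M = mapGL (u : GL (Fin 3) K) (latt (Matrix.diagonal ![(1 : K), 1, ϖ])) := by
  have hϖ0 : ϖ ≠ 0 := uniformizer_ne_zero hd.vϖ
  have hϖ1 : Valued.v ϖ ≤ 1 := by rw [hd.vϖ, ← WithZero.exp_zero, WithZero.exp_le_exp]; omega
  have herm : ∀ y z : Fin 3 → K, B₀ σ 3 z y = σ (B₀ σ 3 y z) := fun y z => (isHermitianForm_B₀ hd.σσ y z).symm
  obtain ⟨x, f₀, f₂, hxM, hf₀M, hf₂M, hx, hxf₀, hxf₂, hf₀f₀, hf₂f₂, hf₀f₂⟩ := exists_adapted_vectors_of_isVertexLattice_two hd hM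
  have hε0 : B₀ σ 3 x x ≠ 0 := fun h => by rw [h, map_zero] at hx; exact zero_ne_one hx
  have hf₀x : B₀ σ 3 f₀ x = 0 := by rw [herm, hxf₀, map_zero]
  have hf₂x : B₀ σ 3 f₂ x = 0 := by rw [herm, hxf₂, map_zero]
  have hf₂f₀ : B₀ σ 3 f₂ f₀ = ϖ := by rw [herm, hf₀f₂, hd.σϖ]
  -- §37: the determinant class `h(x,x) = N(z)`, `z = det C / ϖ`
  set C : Matrix (Fin 3) (Fin 3) K := (Matrix.of ![f₀, x, f₂])ᵀ with hC
  have hC0 : C.mulVec (Pi.single 0 1) = f₀ := transpose_of_mulVec_single _ 0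
  have hC1 : C.mulVec (Pi.single 1 1) = x := transpose_of_mulVec_single _ 1
  have hC2 : C.mulVec (Pi.single 2 1) = f₂ := transpose_of_mulVec_single _ 2
  have hGram : (C.map σ)ᵀ * (StdForm.antidiagonal 3).over K * C = !![0, 0, ϖ; 0, B₀ σ 3 x x, 0; ϖ, 0, 0] := by
    ext i j
    rw [← B₀_mulVec_single_eq_gram]
    fin_cases i <;> fin_cases j <;>
      simp only [Fin.zero_eta, Fin.mk_one, Fin.reduceFinMk, hC0, hC1, hC2, hf₀f₀, hf₀x, hf₀f₂, hxf₀, hxf₂, hf₂f₀, hf₂x, hf₂f₂] <;> rfl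
  have hdetC : σ C.det * C.det = B₀ σ 3 x x * ϖ ^ 2 := by
    have hdet3 : (!![0, 0, ϖ; 0, B₀ σ 3 x x, 0; ϖ, 0, 0] : Matrix (Fin 3) (Fin 3) K).det = -(B₀ σ 3 x x * ϖ ^ 2) := by
      simp [Matrix.det_fin_three]; ring
    have h := det_gram_three (σ := σ) C
    rw [hGram, hdet3] at h
    linear_combination h
  set z : K := C.det / ϖ with hz
  have hzz : σ z * z = B₀ σ 3 x x := by
    rw [hz, map_div₀, hd.σϖ]
    field_simp
    linear_combination hdetC
  have hvz : Valued.v z = 1 := by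
    apply eq_one_of_mul_self_eq_one
    rw [show Valued.v z * Valued.v z = Valued.v (σ z * z) by rw [map_mul, hd.vσ], hzz]; exact hx
  have hz0 : z ≠ 0 := fun h => by rw [h, map_zero] at hvz; exact zero_ne_one hvz
  have hσz0 : σ z ≠ 0 := (map_ne_zero σ).2 hz0
  -- the unit vector `c₁ = z⁻¹ x`
  set c₁ : Fin 3 → K := z⁻¹ • x with hc₁
  have hc₁M : c₁ ∈ M := smul_mem_of_v_le _ (by rw [map_inv₀, hvz, inv_one]) hxM
  have hc₁c₁ : B₀ σ 3 c₁ c₁ = 1 := by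
    rw [hc₁, form_smul_left, form_smul_right, ← hzz, map_inv₀]; field_simp
  have hc₁f₀ : B₀ σ 3 c₁ f₀ = 0 := by rw [hc₁, form_smul_left, hxf₀, mul_zero]
  have hc₁f₂ : B₀ σ 3 c₁ f₂ = 0 := by rw [hc₁, form_smul_left, hxf₂, mul_zero]
  have hf₀c₁ : B₀ σ 3 f₀ c₁ = 0 := by rw [herm, hc₁f₀, map_zero]
  have hf₂c₁ : B₀ σ 3 f₂ c₁ = 0 := by rw [herm, hc₁f₂, map_zero]
  -- §38: the unitary matrix `u = (f₀ | c₁ | ϖ⁻¹ f₂)`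
  have hσϖi : σ ϖ⁻¹ = ϖ⁻¹ := by rw [map_inv₀, hd.σϖ]
  set U : Matrix (Fin 3) (Fin 3) K := (Matrix.of ![f₀, c₁, ϖ⁻¹ • f₂])ᵀ with hU
  have hU0 : U.mulVec (Pi.single 0 1) = f₀ := transpose_of_mulVec_single _ 0
  have hU1 : U.mulVec (Pi.single 1 1) = c₁ := transpose_of_mulVec_single _ 1
  have hU2 : U.mulVec (Pi.single 2 1) = ϖ⁻¹ • f₂ := transpose_of_mulVec_single _ 2
  have hUJ : (U.map σ)ᵀ * (StdForm.antidiagonal 3).over K * U = (StdForm.antidiagonal 3).over K := by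
    ext i j
    rw [← B₀_mulVec_single_eq_gram, UnitaryGroup.antidiagonal_three_over_eq]
    fin_cases i <;> fin_cases j <;>
      simp only [Fin.zero_eta, Fin.mk_one, Fin.reduceFinMk, hU0, hU1, hU2, form_smul_left, form_smul_right, hσϖi, hf₀f₀, hf₀c₁, hf₀f₂, hc₁f₀, hc₁c₁, hc₁f₂,
        hf₂f₀, hf₂c₁, hf₂f₂, mul_zero, inv_mul_cancel₀ hϖ0] <;> rfl
  have hdetU : U.det ≠ 0 := by
    intro h
    have h2 := congrArg Matrix.det hUJ
    rw [det_gram_three, h, mul_zero, neg_zero, det_antidiagonal_three] at h2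
    norm_num at h2
  set u : GL (Fin 3) K := Matrix.GeneralLinearGroup.mkOfDetNeZero U hdetU with hu
  have huval : (u : Matrix (Fin 3) (Fin 3) K) = U := rfl
  have huU : u ∈ unitaryGroupOfForm σ ((StdForm.antidiagonal 3).over K) := by rw [mem_unitaryGroupOfForm_iff, huval]; exact hUJ
  refine ⟨⟨u, huU⟩, ?_⟩
  change M = mapGL u (latt (Matrix.diagonal ![(1 : K), 1, ϖ]))
  -- `u·N₁ = latt (f₀ | c₁ | f₂) ≤ M`, both type two
  have hle : mapGL u (latt (Matrix.diagonal ![(1 : K), 1, ϖ])) ≤ M := by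
    rw [mapGL_latt_eq, huval, latt_le_iff_forall_mulVec_single_mem]
    intro j
    rw [← Matrix.mulVec_mulVec, Matrix.diagonal_mulVec_single, mul_one]
    fin_cases j
    · simp only [Fin.zero_eta]; rw [show (![(1 : K), 1, ϖ] : Fin 3 → K) 0 = 1 from rfl, hU0]; exact hf₀M
    · simp only [Fin.mk_one]; rw [show (![(1 : K), 1, ϖ] : Fin 3 → K) 1 = 1 from rfl, hU1]; exact hc₁M
    · simp only [Fin.reduceFinMk]; rw [show (![(1 : K), 1, ϖ] : Fin 3 → K) 2 = ϖ from rfl]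
      have h2 : (Pi.single 2 ϖ : Fin 3 → K) = ϖ • Pi.single 2 1 := by
        ext i; rw [Pi.smul_apply, Pi.single_apply, Pi.single_apply, smul_eq_mul, mul_ite, mul_one, mul_zero]
      rw [h2, Matrix.mulVec_smul, hU2, smul_smul, mul_inv_cancel₀ hϖ0, one_smul]; exact hf₂M
  have h2 : IsVertexLattice σ ϖ ((StdForm.antidiagonal 3).over K) 2 (mapGL u (latt (Matrix.diagonal ![(1 : K), 1, ϖ]))) :=
    isVertexLattice_mapGL σ ϖ _ u huU (isVertexLattice_two_latt_diagonal_one_one hd.σϖ hϖ1 hϖ0)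
  exact (eq_of_le_of_isVertexLattice hd.vσ hϖ0 h2 hM hle).symm

/-! ## §39 Corollaries: the binder `htr₂` discharged; the tree unconditionally in the datum -/

/-- **The binder `htr₂` of ★ `isTree_latticeGraph_three` holds for every unramified datum.** [cite: Jacobowitz1962, §7] [cite: BruhatTits1972, §10] -/
theorem forall_isVertexLattice_two_exists_mapGL_N₁_eq (hd : UnramifiedLocalConjDatum σ ϖ) :
    ∀ M : Submodule 𝒪[K] (Fin 3 → K), IsVertexLattice σ ϖ ((StdForm.antidiagonal 3).over K) 2 M →
      ∃ u : unitaryGroupOfForm σ ((StdForm.antidiagonal 3).over K), M = mapGL (u : GL (Fin 3) K) (latt (Matrix.diagonal ![(1 : K), 1, ϖ])) :=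
  fun _ hM => exists_mapGL_N₁_eq_of_isVertexLattice_two hd hM

/-- **THE LATTICE GRAPH OF `(K³, J₀)` IS A TREE, for every unramified datum** (`hd : UnramifiedLocalConjDatum σ ϖ`, no further hypothesis): the Bruhat–Tits tree of the
unramified `U(3)` in the T1a lattice model — ★ `isTree_latticeGraph_three` with its binder `htr₂` discharged by `exists_mapGL_N₁_eq_of_isVertexLattice_two`.  This is the
hypothesis `hT : G.IsTree` of ★ `TreeDisplacement` at `G = latticeGraph σ ϖ J₀`. [cite: BruhatTits1972, §10] [cite: Tits1979, §3.3.3] [cite: Serre1980Trees, II.1.1] -/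
theorem isTree_latticeGraph_three_of_unramified (hd : UnramifiedLocalConjDatum σ ϖ) : (latticeGraph σ ϖ ((StdForm.antidiagonal 3).over K)).IsTree :=
  isTree_latticeGraph_three hd (forall_isVertexLattice_two_exists_mapGL_N₁_eq hd)

/-- **The parent of a type-two vertex, unconditionally in the datum**: self-dual, strictly above, one depth up (★ `latticeParent_spec_of_isVertexLattice_two` with `htr₂`
discharged). [cite: BruhatTits1972, §10] [cite: Serre1980Trees, II.1.1] -/
theorem latticeParent_spec_of_isVertexLattice_two_of_unramified (hd : UnramifiedLocalConjDatum σ ϖ) {M : Submodule 𝒪[K] (Fin 3 → K)}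
    (hM : IsVertexLattice σ ϖ ((StdForm.antidiagonal 3).over K) 2 M) :
    IsSelfDualLattice σ ϖ ((StdForm.antidiagonal 3).over K) (latticeParent σ ϖ ((StdForm.antidiagonal 3).over K) M) ∧
      M < latticeParent σ ϖ ((StdForm.antidiagonal 3).over K) M ∧
      latticeDepth ϖ (latticeParent σ ϖ ((StdForm.antidiagonal 3).over K) M) + 1 = latticeDepth ϖ M :=
  latticeParent_spec_of_isVertexLattice_two hd (forall_isVertexLattice_two_exists_mapGL_N₁_eq hd) hM

/-- **The type-two normal form, unconditionally in the datum**: every type-two vertex is `κ·t_a·κ″·N₁` with `κ, κ″ ∈ K₀`, `a : ℕ` (★ `exists_normalForm_of_type_two` with `htr₂`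
discharged). [cite: BruhatTits1972, §10] -/
theorem exists_normalForm_of_type_two_of_unramified (hd : UnramifiedLocalConjDatum σ ϖ) {M : Submodule 𝒪[K] (Fin 3 → K)}
    (hM : IsVertexLattice σ ϖ ((StdForm.antidiagonal 3).over K) 2 M) :
    ∃ κ : unitaryGroupOfForm σ ((StdForm.antidiagonal 3).over K), κ ∈ unitaryInt σ ((StdForm.antidiagonal 3).over K) ∧
    ∃ κ'' : unitaryGroupOfForm σ ((StdForm.antidiagonal 3).over K), κ'' ∈ unitaryInt σ ((StdForm.antidiagonal 3).over K) ∧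
    ∃ a : ℕ, M = mapGL (κ : GL (Fin 3) K) (latt (Matrix.diagonal ![ϖ ^ (a : ℤ), 1, ϖ ^ (-(a : ℤ))] *
      (((κ'' : GL (Fin 3) K) : Matrix (Fin 3) (Fin 3) K) * Matrix.diagonal ![(1 : K), 1, ϖ]))) :=
  exists_normalForm_of_type_two hd (forall_isVertexLattice_two_exists_mapGL_N₁_eq hd) hM

end Literature.NumberTheory.Automorphic.UnitaryLatticeTree

end
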